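import Literature.NumberTheory.Rogawski1990.ArchCentralLimitCompactWallCornerTransfer  -- ★ p843067 (A4)-T: the transfer + dictionary (brings wall01 form, ChamberReduction token)
import Literature.NumberTheory.Rogawski1990.ArchCentralLimitCompactWallLeibniz          -- ★ p843013 (A4)-L: `NF`, `N²F`, `N³F` on the compact wall
import Literature.NumberTheory.Rogawski1990.ArchCentralLimitCompactWallValue            -- ★ p843330 (A4)-V: the value from the wall germs `ψ = m·Φ`, `χ = m²·N²Φ`
import HarnessLib

/-!
# The compact-wall reduction of the archimedean central-limit constant

Rogawski, *Automorphic representations of unitary groups in three variables* (1990), §8.4 pp. 126–127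
(Harish-Chandra's limit formula at the centre `ζ·1` of `U(2,1)`), in the chamber-by-chamber form of ★
`ArchCentralLimitFormulaRankTwo.of_chamberExtensions`.  This file COMPOSES the three compact-wall files
(★ corner transfer, ★ normal-line Leibniz readings, ★ value from wall germs) into ONE statement for the
chambers adjacent to the compact wall `{θ₀ = θ₁}` from the side `t > 0` of the wall curve
`t ↦ t·A⃗`, `A⃗ = (1,1,−2)`:

Let `Φ : (S¹)³ → ℂ` be invariant under the compact Weyl reflection `(0 1)` and such that
`θ ↦ Φ(ζ·e^{iθ})` is `C³` on an open set `W` of angles containing the punctured wall points `t·A⃗`,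
`t ∈ (0, δ)` (for the orbital integral: Harish-Chandra's smoothness off the noncompact walls and across
the compact wall).  Let `S` be an open set (a Weyl chamber) whose closure contains these wall points, and
`H` a `C³` function on an open `U ∋ 0` agreeing with `F := (ρ′Δ·Φ)(ζ·e^{iθ})` on `S` (the corner
extension (A6)).  Let `ψ(t) = m(t)·Φ(k_t)` and `χ(t) = m(t)²·(d/ds)²|₀Φ(k_t·e^{isN⃗})`
(`k_t = ζ·e^{itA⃗}`, `m(t) = 2 − 2cos 3t`, `N⃗ = (1,−1,0)`) be `C²` on `[0, δ]`.  THEN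
  `Λ₈^∠[H](0) = −(2/3)i·ψ″(0⁺) − (1/2)i·ψ(0) + (1/12)i·χ″(0⁺)`
and `12ψ(0) = 6χ(0)`, `12ψ′(0⁺) = 6χ′(0⁺)`.  So on these chambers the letter's constant is reduced to
THREE NUMBERS of the `|1 − w|²`-normalised singular orbital integral along the compact wall (the (A3)
deliverable), modulo the existence of the corner extension (A6).
-/

open Filter Topology Set Complex
open scoped ContDiff
open Literature.Analysis.Calculus

namespace Literature.NumberTheory.Rogawski1990

section Reduction

/-- The letter's Weyl factor composed with the angle chart, `θ ↦ ρ′Δ(ζ·e^{iθ})`, is smooth. [cite: Rogawski1990, §8.4 p. 126] -/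
theorem contDiff_rhoWeylDelta_angleChart (ζ : Circle) :
    ContDiff ℝ ∞ fun θ : Fin 3 → ℝ =>
      (((ζ * Circle.exp (θ 0) : Circle) : ℂ)) * ((((ζ * Circle.exp (θ 2) : Circle) : ℂ)))⁻¹ *
        ((1 - (((ζ * Circle.exp (θ 1) : Circle) : ℂ)) * ((((ζ * Circle.exp (θ 0) : Circle) : ℂ)))⁻¹) *
          (1 - (((ζ * Circle.exp (θ 2) : Circle) : ℂ)) * ((((ζ * Circle.exp (θ 1) : Circle) : ℂ)))⁻¹) *
          (1 - (((ζ * Circle.exp (θ 2) : Circle) : ℂ)) * ((((ζ * Circle.exp (θ 0) : Circle) : ℂ)))⁻¹)) := by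
  have hc : ∀ j : Fin 3, ContDiff ℝ ∞ fun θ : Fin 3 → ℝ => (((ζ * Circle.exp (θ j) : Circle) : ℂ)) := by
    intro j
    have h : (fun θ : Fin 3 → ℝ => (((ζ * Circle.exp (θ j) : Circle) : ℂ))) = fun θ => (ζ : ℂ) * Complex.exp (((θ j : ℝ) : ℂ) * I) := by
      funext θ
      rw [Circle.coe_mul, Circle.coe_exp]
    rw [h]
    exact contDiff_const.mul ((Complex.contDiff_exp (𝕜 := ℝ)).comp ((Complex.ofRealCLM.contDiff.comp (contDiff_apply ℝ ℝ j)).mul contDiff_const))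
  have hi : ∀ j : Fin 3, ContDiff ℝ ∞ fun θ : Fin 3 → ℝ => ((((ζ * Circle.exp (θ j) : Circle) : ℂ)))⁻¹ :=
    fun j => (hc j).inv fun θ => Circle.coe_ne_zero _
  exact ((hc 0).mul (hi 2)).mul (((contDiff_const.sub ((hc 1).mul (hi 0))).mul (contDiff_const.sub ((hc 2).mul (hi 1)))).mul
    (contDiff_const.sub ((hc 2).mul (hi 0))))

/-- `m(t) = 2 − 2cos 3t ≠ 0` for `t > 0` small (indeed `m(t)/t² → 9`). [cite: Rogawski1990, §8.4 p. 126] -/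
theorem eventually_nhdsGT_wallNormaliser_ne_zero : ∀ᶠ t : ℝ in 𝓝[>] 0, 2 - 2 * Real.cos (3 * t) ≠ 0 := by
  have hle : 𝓝[>] (0 : ℝ) ≤ 𝓝[≠] 0 := nhdsWithin_mono _ fun x hx => ne_of_gt hx
  have hm2 := tendsto_wallNormaliser_div_sq.mono_left hle
  filter_upwards [hm2.eventually (lt_mem_nhds (by norm_num : (0 : ℝ) < 9))] with t ht
  intro h
  rw [h, zero_div] at ht
  exact lt_irrefl _ ht

/-- **THE COMPACT-WALL REDUCTION (chambers on the side `t > 0` of the wall curve `t·A⃗`).**  See the module docstring: for `Φ` invariant under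
the compact Weyl reflection with `Φ∘chart_ζ` of class `C³` on an open `W` containing the wall points `t·A⃗`, `0 < t < δ`, an open `S` with these
points in its closure, a `C³` corner extension `H` on `U ∋ 0` of `(ρ′Δ·Φ)∘chart_ζ|_S`, and the `|1 − w|²`-normalised wall germs `ψ = m·Φ(k_·)`,
`χ = m²·N²Φ(k_·)` of class `C²` on `[0, δ]`:
`Λ₈^∠[H](0) = −(2/3)i·ψ″(0⁺) − (1/2)i·ψ(0) + (1/12)i·χ″(0⁺)`, `12ψ(0) = 6χ(0)`, `12ψ′(0⁺) = 6χ′(0⁺)`.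
[cite: Rogawski1990, §8.4 pp. 126–127] [cite: Varadarajan1989, §6.4] -/
theorem lambda8Angle_cornerExtension_eq_of_compactWallGerms (Φ : (Fin 3 → Circle) → ℂ)
    (hΦsymm : ∀ z : Fin 3 → Circle, Φ (z ∘ (Equiv.swap (0 : Fin 3) 1)) = Φ z) (ζ : Circle)
    {W : Set (Fin 3 → ℝ)} (hW : IsOpen W) (hΦW : ContDiffOn ℝ 3 (fun θ : Fin 3 → ℝ => Φ (fun j => ζ * Circle.exp (θ j))) W)
    {S U : Set (Fin 3 → ℝ)} (hS : IsOpen S) (hU : IsOpen U) (h0 : (0 : Fin 3 → ℝ) ∈ U)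
    {H : (Fin 3 → ℝ) → ℂ} (hH : ContDiffOn ℝ 3 H U)
    (hHF : EqOn H (fun θ : Fin 3 → ℝ =>
      (((ζ * Circle.exp (θ 0) : Circle) : ℂ)) * ((((ζ * Circle.exp (θ 2) : Circle) : ℂ)))⁻¹ *
        ((1 - (((ζ * Circle.exp (θ 1) : Circle) : ℂ)) * ((((ζ * Circle.exp (θ 0) : Circle) : ℂ)))⁻¹) *
          (1 - (((ζ * Circle.exp (θ 2) : Circle) : ℂ)) * ((((ζ * Circle.exp (θ 1) : Circle) : ℂ)))⁻¹) *
          (1 - (((ζ * Circle.exp (θ 2) : Circle) : ℂ)) * ((((ζ * Circle.exp (θ 0) : Circle) : ℂ)))⁻¹)) *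
        Φ (fun j => ζ * Circle.exp (θ j))) S)
    {δ : ℝ} (hδ : 0 < δ)
    (hwall : ∀ t ∈ Ioo 0 δ, t • (![1, 1, -2] : Fin 3 → ℝ) ∈ U ∧ t • (![1, 1, -2] : Fin 3 → ℝ) ∈ W ∧ t • (![1, 1, -2] : Fin 3 → ℝ) ∈ closure S)
    {ψ χ : ℝ → ℂ} (hψ : ContDiffOn ℝ 2 ψ (Icc 0 δ)) (hχ : ContDiffOn ℝ 2 χ (Icc 0 δ))
    (hψdef : ∀ t ∈ Ioo 0 δ, ψ t = ((2 - 2 * Real.cos (3 * t) : ℝ) : ℂ) * Φ (fun j => ζ * Circle.exp ((t • (![1, 1, -2] : Fin 3 → ℝ)) j)))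
    (hχdef : ∀ t ∈ Ioo 0 δ, χ t = ((2 - 2 * Real.cos (3 * t) : ℝ) : ℂ) ^ 2 *
      iteratedDeriv 2 (fun s : ℝ => Φ (fun j => (fun i : Fin 3 => ζ * Circle.exp ((t • (![1, 1, -2] : Fin 3 → ℝ)) i)) j *
        Circle.exp (s * (![1, -1, 0] : Fin 3 → ℝ) j))) 0) :
    (1 / 48 : ℂ) * ∑ ε : Fin 3 → Bool, ((((if ε 0 then (1 : ℝ) else -1) * (if ε 1 then (1 : ℝ) else -1) * (if ε 2 then (1 : ℝ) else -1) : ℝ)) : ℂ) *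
        iteratedDeriv 3 (fun s : ℝ => H (s • (![(if ε 0 then (1 : ℝ) else -1) + (if ε 1 then (1 : ℝ) else -1), -(if ε 0 then (1 : ℝ) else -1) + (if ε 2 then (1 : ℝ) else -1),
          -(if ε 1 then (1 : ℝ) else -1) - (if ε 2 then (1 : ℝ) else -1)]))) 0 =
        -(2 / 3) * I * iteratedDerivWithin 2 ψ (Icc 0 δ) 0 - (1 / 2) * I * ψ 0 + (1 / 12) * I * iteratedDerivWithin 2 χ (Icc 0 δ) 0 ∧
      12 * ψ 0 = 6 * χ 0 ∧ 12 * derivWithin ψ (Icc 0 δ) 0 = 6 * derivWithin χ (Icc 0 δ) 0 := by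
  -- the honest function `F = (ρ′Δ·Φ)∘chart_ζ` is `C³` on `W`
  set F : (Fin 3 → ℝ) → ℂ := fun θ : Fin 3 → ℝ =>
      (((ζ * Circle.exp (θ 0) : Circle) : ℂ)) * ((((ζ * Circle.exp (θ 2) : Circle) : ℂ)))⁻¹ *
        ((1 - (((ζ * Circle.exp (θ 1) : Circle) : ℂ)) * ((((ζ * Circle.exp (θ 0) : Circle) : ℂ)))⁻¹) *
          (1 - (((ζ * Circle.exp (θ 2) : Circle) : ℂ)) * ((((ζ * Circle.exp (θ 1) : Circle) : ℂ)))⁻¹) *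
          (1 - (((ζ * Circle.exp (θ 2) : Circle) : ℂ)) * ((((ζ * Circle.exp (θ 0) : Circle) : ℂ)))⁻¹)) *
        Φ (fun j => ζ * Circle.exp (θ j)) with hFdef
  have hF : ContDiffOn ℝ 3 F W :=
    ((contDiff_rhoWeylDelta_angleChart ζ).of_le (by exact_mod_cast ENat.natCast_le_of_coe_top_le_withTop le_rfl 3)).contDiffOn.mul hΦW
  -- (A4)-T: the two wall jets of `F` converge to the corner jets of `H` along `𝓝[>] 0`
  have hl : 𝓝[>] (0 : ℝ) ≤ 𝓝 0 := nhdsWithin_le_nhds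
  have hIoo : ∀ᶠ t : ℝ in 𝓝[>] 0, t ∈ Ioo 0 δ := Ioo_mem_nhdsGT hδ
  have hwall' : ∀ᶠ t : ℝ in 𝓝[>] 0, t • (![1, 1, -2] : Fin 3 → ℝ) ∈ U ∧ t • (![1, 1, -2] : Fin 3 → ℝ) ∈ W ∧ t • (![1, 1, -2] : Fin 3 → ℝ) ∈ closure S := by
    filter_upwards [hIoo] with t ht using hwall t ht
  obtain ⟨hT3, hT2⟩ := tendsto_wall01_jets_of_cornerExtension H F hS hHF hU h0 hH hW hF hl hwall'
  -- the wall point `k_t` and the dictionary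
  have hk01 : ∀ t : ℝ, (fun j : Fin 3 => ζ * Circle.exp ((t • (![1, 1, -2] : Fin 3 → ℝ)) j)) 0 = (fun j : Fin 3 => ζ * Circle.exp ((t • (![1, 1, -2] : Fin 3 → ℝ)) j)) 1 :=
    fun t => angleChart_wall01_apply_zero_eq_one ζ t
  have hray : ∀ t : ℝ, (fun s : ℝ => F (t • (![1, 1, -2] : Fin 3 → ℝ) + s • (![1, -1, 0] : Fin 3 → ℝ))) = fun s : ℝ =>
      (fun z' : Fin 3 → Circle => ((z' 0 : ℂ) * ((z' 2 : ℂ))⁻¹ *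
          ((1 - (z' 1 : ℂ) * ((z' 0 : ℂ))⁻¹) * (1 - (z' 2 : ℂ) * ((z' 1 : ℂ))⁻¹) * (1 - (z' 2 : ℂ) * ((z' 0 : ℂ))⁻¹))) * Φ z')
        (fun j => (fun i : Fin 3 => ζ * Circle.exp ((t • (![1, 1, -2] : Fin 3 → ℝ)) i)) j * Circle.exp (s * (![1, -1, 0] : Fin 3 → ℝ) j)) := by
    intro t
    funext s
    have h := angleChart_wall01_add_normal ζ t s
    have h0 := congrFun h 0
    have h1 := congrFun h 1
    have h2 := congrFun h 2
    simp only [hFdef]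
    rw [h, h0, h1, h2]
  -- smoothness of `Φ` along the normal ray at `k_t`, `t ∈ (0, δ)`
  have hP : ∀ t ∈ Ioo 0 δ, ContDiffAt ℝ 3 (fun s : ℝ => Φ (fun j => (fun i : Fin 3 => ζ * Circle.exp ((t • (![1, 1, -2] : Fin 3 → ℝ)) i)) j * Circle.exp (s * (![1, -1, 0] : Fin 3 → ℝ) j))) 0 := by
    intro t ht
    have hmem : t • (![1, 1, -2] : Fin 3 → ℝ) + (0 : ℝ) • (![1, -1, 0] : Fin 3 → ℝ) ∈ W := by simpa only [zero_smul, add_zero] using (hwall t ht).2.1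
    have hline : ContDiff ℝ 3 (fun s : ℝ => t • (![1, 1, -2] : Fin 3 → ℝ) + s • (![1, -1, 0] : Fin 3 → ℝ)) :=
      contDiff_const.add (contDiff_id.smul contDiff_const)
    have hcomp : ContDiffAt ℝ 3 ((fun θ : Fin 3 → ℝ => Φ (fun j => ζ * Circle.exp (θ j))) ∘ (fun s : ℝ => t • (![1, 1, -2] : Fin 3 → ℝ) + s • (![1, -1, 0] : Fin 3 → ℝ))) 0 :=
      (hΦW.contDiffAt (hW.mem_nhds hmem)).comp 0 hline.contDiffAt
    refine hcomp.congr_of_eventuallyEq (Eventually.of_forall fun s => ?_)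
    simp only [Function.comp_apply, angleChart_wall01_add_normal ζ t s]
  -- the ★ Leibniz coefficients at `k_t` as functions of `t`
  have hcoef : ∀ t : ℝ,
      2 * I * ((((fun j : Fin 3 => ζ * Circle.exp ((t • (![1, 1, -2] : Fin 3 → ℝ)) j)) 0 : Circle) : ℂ) * ((((fun j : Fin 3 => ζ * Circle.exp ((t • (![1, 1, -2] : Fin 3 → ℝ)) j)) 2 : Circle) : ℂ))⁻¹) *
          (1 - (((fun j : Fin 3 => ζ * Circle.exp ((t • (![1, 1, -2] : Fin 3 → ℝ)) j)) 2 : Circle) : ℂ) * ((((fun j : Fin 3 => ζ * Circle.exp ((t • (![1, 1, -2] : Fin 3 → ℝ)) j)) 0 : Circle) : ℂ))⁻¹) ^ 2 =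
        -2 * I * ((2 - 2 * Real.cos (3 * t) : ℝ) : ℂ) ∧
      2 * I * ((((fun j : Fin 3 => ζ * Circle.exp ((t • (![1, 1, -2] : Fin 3 → ℝ)) j)) 0 : Circle) : ℂ) * ((((fun j : Fin 3 => ζ * Circle.exp ((t • (![1, 1, -2] : Fin 3 → ℝ)) j)) 2 : Circle) : ℂ))⁻¹) *
          (8 * ((((fun j : Fin 3 => ζ * Circle.exp ((t • (![1, 1, -2] : Fin 3 → ℝ)) j)) 2 : Circle) : ℂ) * ((((fun j : Fin 3 => ζ * Circle.exp ((t • (![1, 1, -2] : Fin 3 → ℝ)) j)) 0 : Circle) : ℂ))⁻¹) - 1 -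
            ((((fun j : Fin 3 => ζ * Circle.exp ((t • (![1, 1, -2] : Fin 3 → ℝ)) j)) 2 : Circle) : ℂ) * ((((fun j : Fin 3 => ζ * Circle.exp ((t • (![1, 1, -2] : Fin 3 → ℝ)) j)) 0 : Circle) : ℂ))⁻¹) ^ 2) =
        12 * I + 2 * I * ((2 - 2 * Real.cos (3 * t) : ℝ) : ℂ) := by
    intro t
    obtain ⟨h02, h20⟩ := wallPoint_ratio ζ t
    rw [h02, h20, firstJetCoeff_eq_wallNormaliser, thirdJetCoeff_eq_wallNormaliser]
    exact ⟨rfl, rfl⟩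
  -- (i) the normal cube `N³F(k_t)` in germ form, eventually along `𝓝[>] 0`
  have hcube : ∀ᶠ t : ℝ in 𝓝[>] 0, iteratedDeriv 3 (fun s : ℝ => F (t • (![1, 1, -2] : Fin 3 → ℝ) + s • (![1, -1, 0] : Fin 3 → ℝ))) 0 =
      2 * I * ψ t + (12 * I * ψ t - 6 * I * χ t) / ((2 - 2 * Real.cos (3 * t) : ℝ) : ℂ) := by
    filter_upwards [hIoo, eventually_nhdsGT_wallNormaliser_ne_zero] with t ht hm
    have hm' : (((2 - 2 * Real.cos (3 * t) : ℝ)) : ℂ) ≠ 0 := by exact_mod_cast hm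
    rw [hray t, iteratedDeriv_three_rhoWeylDelta_mul_normalRay_zero Φ hΦsymm _ (hk01 t) (hP t ht), (hcoef t).1, (hcoef t).2,
      hψdef t ht, hχdef t ht]
    generalize (((2 - 2 * Real.cos (3 * t) : ℝ)) : ℂ) = M at hm' ⊢
    generalize Φ (fun j : Fin 3 => ζ * Circle.exp ((t • (![1, 1, -2] : Fin 3 → ℝ)) j)) = Φk
    generalize iteratedDeriv 2 (fun s : ℝ => Φ (fun j => (fun i : Fin 3 => ζ * Circle.exp ((t • (![1, 1, -2] : Fin 3 → ℝ)) i)) j *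
        Circle.exp (s * (![1, -1, 0] : Fin 3 → ℝ) j))) 0 = P
    field_simp
    ring
  -- (ii) the first normal derivative `NF(k_τ) = −2i·ψ(τ)` for `τ ∈ (0, δ)`, hence the mixed jet is `(−2iψ)″(t)`
  have hfirst : ∀ τ ∈ Ioo 0 δ, deriv (fun s : ℝ => F (τ • (![1, 1, -2] : Fin 3 → ℝ) + s • (![1, -1, 0] : Fin 3 → ℝ))) 0 = -2 * I * ψ τ := by
    intro τ hτ
    rw [hray τ, deriv_rhoWeylDelta_mul_normalRay_zero Φ _ (hk01 τ) ((hP τ hτ).of_le (by norm_num)), (hcoef τ).1, hψdef τ hτ]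
    ring
  have hmixed : ∀ᶠ t : ℝ in 𝓝[>] 0, iteratedDeriv 2 (fun τ : ℝ => deriv (fun s : ℝ => F (t • (![1, 1, -2] : Fin 3 → ℝ) + τ • (![1, 1, -2] : Fin 3 → ℝ) + s • (![1, -1, 0] : Fin 3 → ℝ))) 0) 0 =
      iteratedDeriv 2 (fun τ : ℝ => -2 * I * ψ τ) t := by
    filter_upwards [hIoo] with t ht
    have hev : (fun τ : ℝ => deriv (fun s : ℝ => F (t • (![1, 1, -2] : Fin 3 → ℝ) + τ • (![1, 1, -2] : Fin 3 → ℝ) + s • (![1, -1, 0] : Fin 3 → ℝ))) 0) =ᶠ[𝓝 0] fun τ : ℝ => (fun τ' : ℝ => -2 * I * ψ τ') (t + τ) := by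
      have hmem : ∀ᶠ τ : ℝ in 𝓝 0, t + τ ∈ Ioo 0 δ := by
        have hc : Continuous fun τ : ℝ => t + τ := by fun_prop
        exact hc.continuousAt.eventually_mem (by simpa only [add_zero] using isOpen_Ioo.mem_nhds ht)
      filter_upwards [hmem] with τ hτ
      rw [← hfirst (t + τ) hτ, add_smul]
    rw [hev.iteratedDeriv_eq 2, iteratedDeriv_comp_const_add 2 (fun τ' : ℝ => -2 * I * ψ τ') t]
    simp only [add_zero]
  -- the two limits in the form ★ (A4)-V consumes
  have hL₁ : Tendsto (fun t : ℝ => iteratedDeriv 2 (fun τ : ℝ => -2 * I * ψ τ) t) (𝓝[>] 0)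
      (𝓝 (iteratedFDeriv ℝ 3 H 0 ![(![1, 1, -2] : Fin 3 → ℝ), (![1, 1, -2] : Fin 3 → ℝ), (![1, -1, 0] : Fin 3 → ℝ)])) := hT2.congr' hmixed
  have hL₂ : Tendsto (fun t : ℝ => 2 * I * ψ t + (12 * I * ψ t - 6 * I * χ t) / ((2 - 2 * Real.cos (3 * t) : ℝ) : ℂ)) (𝓝[>] 0)
      (𝓝 (iteratedFDeriv ℝ 3 H 0 ![(![1, -1, 0] : Fin 3 → ℝ), (![1, -1, 0] : Fin 3 → ℝ), (![1, -1, 0] : Fin 3 → ℝ)])) := hT3.congr' hcube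
  obtain ⟨hval, hrel0, hrel1⟩ := quarter_sub_eq_of_wallGerms hδ hψ hχ hL₁ hL₂
  refine ⟨?_, hrel0, hrel1⟩
  rw [lambda8Angle_zero_eq_quarter_wall01_form H hU h0 hH]
  exact hval

end Reduction

/-! ## ED. 2 (F0P3a-p06 (g11), 2026-09-01) — the mirror side `t < 0` of the wall curve

The other two compact-adjacent chambers `{θ₀<θ₁<θ₂}, {θ₁<θ₀<θ₂}` touch the wall points `t·A⃗` with `t < 0`.  Writing
`t = −u`, `u ∈ (0, δ)`, the germs are `ψ₋(u) = m(u)·Φ(k_{−u})`, `χ₋(u) = m(u)²·N²Φ(k_{−u})` (`m` is even) and the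
same value formula holds with `ψ₋, χ₋` (the mixed jet picks up `(−1)² = 1`). -/

section ReductionNeg

/-- `m` is even: `2 − 2cos(3·(−u)) = 2 − 2cos 3u` (as a complex number). [cite: Rogawski1990, §8.4 p. 126] -/
theorem wallNormaliser_neg (u : ℝ) : (((2 - 2 * Real.cos (3 * -u) : ℝ)) : ℂ) = (((2 - 2 * Real.cos (3 * u) : ℝ)) : ℂ) := by
  rw [mul_neg, Real.cos_neg]

/-- **THE COMPACT-WALL REDUCTION, mirror side (chambers touching `t·A⃗`, `t < 0`).**  Same hypotheses as
`lambda8Angle_cornerExtension_eq_of_compactWallGerms` with the wall points `(−u)·A⃗`, `u ∈ (0, δ)`, and the germs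
`ψ(u) = m(u)·Φ(k_{−u})`, `χ(u) = m(u)²·(d/ds)²|₀ Φ(k_{−u}·e^{isN⃗})` of class `C²` on `[0, δ]`:
`Λ₈^∠[H](0) = −(2/3)i·ψ″(0⁺) − (1/2)i·ψ(0) + (1/12)i·χ″(0⁺)`, `12ψ(0) = 6χ(0)`, `12ψ′(0⁺) = 6χ′(0⁺)`.
[cite: Rogawski1990, §8.4 pp. 126–127] [cite: Varadarajan1989, §6.4] -/
theorem lambda8Angle_cornerExtension_eq_of_compactWallGerms_neg (Φ : (Fin 3 → Circle) → ℂ)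
    (hΦsymm : ∀ z : Fin 3 → Circle, Φ (z ∘ (Equiv.swap (0 : Fin 3) 1)) = Φ z) (ζ : Circle)
    {W : Set (Fin 3 → ℝ)} (hW : IsOpen W) (hΦW : ContDiffOn ℝ 3 (fun θ : Fin 3 → ℝ => Φ (fun j => ζ * Circle.exp (θ j))) W)
    {S U : Set (Fin 3 → ℝ)} (hS : IsOpen S) (hU : IsOpen U) (h0 : (0 : Fin 3 → ℝ) ∈ U)
    {H : (Fin 3 → ℝ) → ℂ} (hH : ContDiffOn ℝ 3 H U)
    (hHF : EqOn H (fun θ : Fin 3 → ℝ =>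
      (((ζ * Circle.exp (θ 0) : Circle) : ℂ)) * ((((ζ * Circle.exp (θ 2) : Circle) : ℂ)))⁻¹ *
        ((1 - (((ζ * Circle.exp (θ 1) : Circle) : ℂ)) * ((((ζ * Circle.exp (θ 0) : Circle) : ℂ)))⁻¹) *
          (1 - (((ζ * Circle.exp (θ 2) : Circle) : ℂ)) * ((((ζ * Circle.exp (θ 1) : Circle) : ℂ)))⁻¹) *
          (1 - (((ζ * Circle.exp (θ 2) : Circle) : ℂ)) * ((((ζ * Circle.exp (θ 0) : Circle) : ℂ)))⁻¹)) *
        Φ (fun j => ζ * Circle.exp (θ j))) S)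
    {δ : ℝ} (hδ : 0 < δ)
    (hwall : ∀ u ∈ Ioo 0 δ, (-u) • (![1, 1, -2] : Fin 3 → ℝ) ∈ U ∧ (-u) • (![1, 1, -2] : Fin 3 → ℝ) ∈ W ∧ (-u) • (![1, 1, -2] : Fin 3 → ℝ) ∈ closure S)
    {ψ χ : ℝ → ℂ} (hψ : ContDiffOn ℝ 2 ψ (Icc 0 δ)) (hχ : ContDiffOn ℝ 2 χ (Icc 0 δ))
    (hψdef : ∀ u ∈ Ioo 0 δ, ψ u = ((2 - 2 * Real.cos (3 * u) : ℝ) : ℂ) * Φ (fun j => ζ * Circle.exp (((-u) • (![1, 1, -2] : Fin 3 → ℝ)) j)))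
    (hχdef : ∀ u ∈ Ioo 0 δ, χ u = ((2 - 2 * Real.cos (3 * u) : ℝ) : ℂ) ^ 2 *
      iteratedDeriv 2 (fun s : ℝ => Φ (fun j => (fun i : Fin 3 => ζ * Circle.exp (((-u) • (![1, 1, -2] : Fin 3 → ℝ)) i)) j *
        Circle.exp (s * (![1, -1, 0] : Fin 3 → ℝ) j))) 0) :
    (1 / 48 : ℂ) * ∑ ε : Fin 3 → Bool, ((((if ε 0 then (1 : ℝ) else -1) * (if ε 1 then (1 : ℝ) else -1) * (if ε 2 then (1 : ℝ) else -1) : ℝ)) : ℂ) *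
        iteratedDeriv 3 (fun s : ℝ => H (s • (![(if ε 0 then (1 : ℝ) else -1) + (if ε 1 then (1 : ℝ) else -1), -(if ε 0 then (1 : ℝ) else -1) + (if ε 2 then (1 : ℝ) else -1),
          -(if ε 1 then (1 : ℝ) else -1) - (if ε 2 then (1 : ℝ) else -1)]))) 0 =
        -(2 / 3) * I * iteratedDerivWithin 2 ψ (Icc 0 δ) 0 - (1 / 2) * I * ψ 0 + (1 / 12) * I * iteratedDerivWithin 2 χ (Icc 0 δ) 0 ∧
      12 * ψ 0 = 6 * χ 0 ∧ 12 * derivWithin ψ (Icc 0 δ) 0 = 6 * derivWithin χ (Icc 0 δ) 0 := by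
  -- the honest function `F = (ρ′Δ·Φ)∘chart_ζ` is `C³` on `W`
  set F : (Fin 3 → ℝ) → ℂ := fun θ : Fin 3 → ℝ =>
      (((ζ * Circle.exp (θ 0) : Circle) : ℂ)) * ((((ζ * Circle.exp (θ 2) : Circle) : ℂ)))⁻¹ *
        ((1 - (((ζ * Circle.exp (θ 1) : Circle) : ℂ)) * ((((ζ * Circle.exp (θ 0) : Circle) : ℂ)))⁻¹) *
          (1 - (((ζ * Circle.exp (θ 2) : Circle) : ℂ)) * ((((ζ * Circle.exp (θ 1) : Circle) : ℂ)))⁻¹) *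
          (1 - (((ζ * Circle.exp (θ 2) : Circle) : ℂ)) * ((((ζ * Circle.exp (θ 0) : Circle) : ℂ)))⁻¹)) *
        Φ (fun j => ζ * Circle.exp (θ j)) with hFdef
  have hF : ContDiffOn ℝ 3 F W :=
    ((contDiff_rhoWeylDelta_angleChart ζ).of_le (by exact_mod_cast ENat.natCast_le_of_coe_top_le_withTop le_rfl 3)).contDiffOn.mul hΦW
  -- (A4)-T along `𝓝[<] 0`, then reflected to `𝓝[>] 0` by `u ↦ −u`
  have hl : 𝓝[<] (0 : ℝ) ≤ 𝓝 0 := nhdsWithin_le_nhds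
  have hIooNeg : ∀ᶠ t : ℝ in 𝓝[<] 0, t ∈ Ioo (-δ) 0 := Ioo_mem_nhdsLT (by linarith)
  have hwall' : ∀ᶠ t : ℝ in 𝓝[<] 0, t • (![1, 1, -2] : Fin 3 → ℝ) ∈ U ∧ t • (![1, 1, -2] : Fin 3 → ℝ) ∈ W ∧ t • (![1, 1, -2] : Fin 3 → ℝ) ∈ closure S := by
    filter_upwards [hIooNeg] with t ht
    have h := hwall (-t) ⟨by linarith [ht.2], by linarith [ht.1]⟩
    simpa only [neg_neg] using h
  obtain ⟨hT3, hT2⟩ := tendsto_wall01_jets_of_cornerExtension H F hS hHF hU h0 hH hW hF hl hwall'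
  have hneg : Tendsto (fun u : ℝ => -u) (𝓝[>] (0 : ℝ)) (𝓝[<] 0) := by
    simpa using (tendsto_neg_nhdsGT (a := (0 : ℝ)))
  have hT3' := hT3.comp hneg
  have hT2' := hT2.comp hneg
  have hIoo : ∀ᶠ u : ℝ in 𝓝[>] 0, u ∈ Ioo 0 δ := Ioo_mem_nhdsGT hδ
  -- the wall point `k_{−u}` and the dictionary (any real parameter)
  have hk01 : ∀ t : ℝ, (fun j : Fin 3 => ζ * Circle.exp ((t • (![1, 1, -2] : Fin 3 → ℝ)) j)) 0 = (fun j : Fin 3 => ζ * Circle.exp ((t • (![1, 1, -2] : Fin 3 → ℝ)) j)) 1 :=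
    fun t => angleChart_wall01_apply_zero_eq_one ζ t
  have hray : ∀ t : ℝ, (fun s : ℝ => F (t • (![1, 1, -2] : Fin 3 → ℝ) + s • (![1, -1, 0] : Fin 3 → ℝ))) = fun s : ℝ =>
      (fun z' : Fin 3 → Circle => ((z' 0 : ℂ) * ((z' 2 : ℂ))⁻¹ *
          ((1 - (z' 1 : ℂ) * ((z' 0 : ℂ))⁻¹) * (1 - (z' 2 : ℂ) * ((z' 1 : ℂ))⁻¹) * (1 - (z' 2 : ℂ) * ((z' 0 : ℂ))⁻¹))) * Φ z')
        (fun j => (fun i : Fin 3 => ζ * Circle.exp ((t • (![1, 1, -2] : Fin 3 → ℝ)) i)) j * Circle.exp (s * (![1, -1, 0] : Fin 3 → ℝ) j)) := by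
    intro t
    funext s
    have h := angleChart_wall01_add_normal ζ t s
    have h0 := congrFun h 0
    have h1 := congrFun h 1
    have h2 := congrFun h 2
    simp only [hFdef]
    rw [h, h0, h1, h2]
  -- smoothness of `Φ` along the normal ray at `k_{−u}`, `u ∈ (0, δ)`
  have hP : ∀ u ∈ Ioo 0 δ, ContDiffAt ℝ 3 (fun s : ℝ => Φ (fun j => (fun i : Fin 3 => ζ * Circle.exp (((-u) • (![1, 1, -2] : Fin 3 → ℝ)) i)) j * Circle.exp (s * (![1, -1, 0] : Fin 3 → ℝ) j))) 0 := by
    intro u hu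
    have hmem : (-u) • (![1, 1, -2] : Fin 3 → ℝ) + (0 : ℝ) • (![1, -1, 0] : Fin 3 → ℝ) ∈ W := by simpa only [zero_smul, add_zero] using (hwall u hu).2.1
    have hline : ContDiff ℝ 3 (fun s : ℝ => (-u) • (![1, 1, -2] : Fin 3 → ℝ) + s • (![1, -1, 0] : Fin 3 → ℝ)) :=
      contDiff_const.add (contDiff_id.smul contDiff_const)
    have hcomp : ContDiffAt ℝ 3 ((fun θ : Fin 3 → ℝ => Φ (fun j => ζ * Circle.exp (θ j))) ∘ (fun s : ℝ => (-u) • (![1, 1, -2] : Fin 3 → ℝ) + s • (![1, -1, 0] : Fin 3 → ℝ))) 0 :=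
      (hΦW.contDiffAt (hW.mem_nhds hmem)).comp 0 hline.contDiffAt
    refine hcomp.congr_of_eventuallyEq (Eventually.of_forall fun s => ?_)
    simp only [Function.comp_apply, angleChart_wall01_add_normal ζ (-u) s]
  -- the ★ Leibniz coefficients at `k_{−u}` as functions of `u` (`m` even)
  have hcoef : ∀ u : ℝ,
      2 * I * ((((fun j : Fin 3 => ζ * Circle.exp (((-u) • (![1, 1, -2] : Fin 3 → ℝ)) j)) 0 : Circle) : ℂ) * ((((fun j : Fin 3 => ζ * Circle.exp (((-u) • (![1, 1, -2] : Fin 3 → ℝ)) j)) 2 : Circle) : ℂ))⁻¹) *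
          (1 - (((fun j : Fin 3 => ζ * Circle.exp (((-u) • (![1, 1, -2] : Fin 3 → ℝ)) j)) 2 : Circle) : ℂ) * ((((fun j : Fin 3 => ζ * Circle.exp (((-u) • (![1, 1, -2] : Fin 3 → ℝ)) j)) 0 : Circle) : ℂ))⁻¹) ^ 2 =
        -2 * I * ((2 - 2 * Real.cos (3 * u) : ℝ) : ℂ) ∧
      2 * I * ((((fun j : Fin 3 => ζ * Circle.exp (((-u) • (![1, 1, -2] : Fin 3 → ℝ)) j)) 0 : Circle) : ℂ) * ((((fun j : Fin 3 => ζ * Circle.exp (((-u) • (![1, 1, -2] : Fin 3 → ℝ)) j)) 2 : Circle) : ℂ))⁻¹) *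
          (8 * ((((fun j : Fin 3 => ζ * Circle.exp (((-u) • (![1, 1, -2] : Fin 3 → ℝ)) j)) 2 : Circle) : ℂ) * ((((fun j : Fin 3 => ζ * Circle.exp (((-u) • (![1, 1, -2] : Fin 3 → ℝ)) j)) 0 : Circle) : ℂ))⁻¹) - 1 -
            ((((fun j : Fin 3 => ζ * Circle.exp (((-u) • (![1, 1, -2] : Fin 3 → ℝ)) j)) 2 : Circle) : ℂ) * ((((fun j : Fin 3 => ζ * Circle.exp (((-u) • (![1, 1, -2] : Fin 3 → ℝ)) j)) 0 : Circle) : ℂ))⁻¹) ^ 2) =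
        12 * I + 2 * I * ((2 - 2 * Real.cos (3 * u) : ℝ) : ℂ) := by
    intro u
    obtain ⟨h02, h20⟩ := wallPoint_ratio ζ (-u)
    rw [h02, h20, firstJetCoeff_eq_wallNormaliser, thirdJetCoeff_eq_wallNormaliser, wallNormaliser_neg]
    exact ⟨rfl, rfl⟩
  -- (i) the normal cube at `k_{−u}` in germ form
  have hcube : ∀ᶠ u : ℝ in 𝓝[>] 0, iteratedDeriv 3 (fun s : ℝ => F ((-u) • (![1, 1, -2] : Fin 3 → ℝ) + s • (![1, -1, 0] : Fin 3 → ℝ))) 0 =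
      2 * I * ψ u + (12 * I * ψ u - 6 * I * χ u) / ((2 - 2 * Real.cos (3 * u) : ℝ) : ℂ) := by
    filter_upwards [hIoo, eventually_nhdsGT_wallNormaliser_ne_zero] with u hu hm
    have hm' : (((2 - 2 * Real.cos (3 * u) : ℝ)) : ℂ) ≠ 0 := by exact_mod_cast hm
    rw [hray (-u), iteratedDeriv_three_rhoWeylDelta_mul_normalRay_zero Φ hΦsymm _ (hk01 (-u)) (hP u hu), (hcoef u).1, (hcoef u).2,
      hψdef u hu, hχdef u hu]
    generalize (((2 - 2 * Real.cos (3 * u) : ℝ)) : ℂ) = M at hm' ⊢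
    generalize Φ (fun j : Fin 3 => ζ * Circle.exp (((-u) • (![1, 1, -2] : Fin 3 → ℝ)) j)) = Φk
    generalize iteratedDeriv 2 (fun s : ℝ => Φ (fun j => (fun i : Fin 3 => ζ * Circle.exp (((-u) • (![1, 1, -2] : Fin 3 → ℝ)) i)) j *
        Circle.exp (s * (![1, -1, 0] : Fin 3 → ℝ) j))) 0 = P
    field_simp
    ring
  -- (ii) the first normal derivative `NF(k_{−v}) = −2i·ψ(v)` for `v ∈ (0, δ)`; the mixed jet at `(−u)·A⃗` is `ψ″`-type at `u`
  have hfirst : ∀ v ∈ Ioo 0 δ, deriv (fun s : ℝ => F ((-v) • (![1, 1, -2] : Fin 3 → ℝ) + s • (![1, -1, 0] : Fin 3 → ℝ))) 0 = -2 * I * ψ v := by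
    intro v hv
    rw [hray (-v), deriv_rhoWeylDelta_mul_normalRay_zero Φ _ (hk01 (-v)) ((hP v hv).of_le (by norm_num)), (hcoef v).1, hψdef v hv]
    ring
  have hmixed : ∀ᶠ u : ℝ in 𝓝[>] 0, iteratedDeriv 2 (fun τ : ℝ => deriv (fun s : ℝ => F ((-u) • (![1, 1, -2] : Fin 3 → ℝ) + τ • (![1, 1, -2] : Fin 3 → ℝ) + s • (![1, -1, 0] : Fin 3 → ℝ))) 0) 0 =
      iteratedDeriv 2 (fun τ : ℝ => -2 * I * ψ τ) u := by
    filter_upwards [hIoo] with u hu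
    have hev : (fun τ : ℝ => deriv (fun s : ℝ => F ((-u) • (![1, 1, -2] : Fin 3 → ℝ) + τ • (![1, 1, -2] : Fin 3 → ℝ) + s • (![1, -1, 0] : Fin 3 → ℝ))) 0) =ᶠ[𝓝 0]
        fun τ : ℝ => (fun x : ℝ => (fun τ' : ℝ => -2 * I * ψ τ') (u + x)) (-τ) := by
      have hmem : ∀ᶠ τ : ℝ in 𝓝 0, u - τ ∈ Ioo 0 δ := by
        have hc : Continuous fun τ : ℝ => u - τ := by fun_prop
        exact hc.continuousAt.eventually_mem (by simpa only [sub_zero] using isOpen_Ioo.mem_nhds hu)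
      filter_upwards [hmem] with τ hτ
      have h := hfirst (u - τ) hτ
      have hpt : (-u) • (![1, 1, -2] : Fin 3 → ℝ) + τ • (![1, 1, -2] : Fin 3 → ℝ) = (-(u - τ)) • (![1, 1, -2] : Fin 3 → ℝ) := by
        rw [← add_smul]
        congr 1
        ring
      rw [hpt, h]
      show -2 * I * ψ (u - τ) = -2 * I * ψ (u + -τ)
      rw [sub_eq_add_neg]
    rw [hev.iteratedDeriv_eq 2, iteratedDeriv_comp_neg 2 (fun x : ℝ => (fun τ' : ℝ => -2 * I * ψ τ') (u + x)) 0, neg_zero,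
      iteratedDeriv_comp_const_add 2 (fun τ' : ℝ => -2 * I * ψ τ') u]
    norm_num
  -- the two limits in the form ★ (A4)-V consumes
  have hL₁ : Tendsto (fun u : ℝ => iteratedDeriv 2 (fun τ : ℝ => -2 * I * ψ τ) u) (𝓝[>] 0)
      (𝓝 (iteratedFDeriv ℝ 3 H 0 ![(![1, 1, -2] : Fin 3 → ℝ), (![1, 1, -2] : Fin 3 → ℝ), (![1, -1, 0] : Fin 3 → ℝ)])) := by
    refine hT2'.congr' ?_
    filter_upwards [hmixed] with u hu
    simpa only [Function.comp_apply] using hu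
  have hL₂ : Tendsto (fun u : ℝ => 2 * I * ψ u + (12 * I * ψ u - 6 * I * χ u) / ((2 - 2 * Real.cos (3 * u) : ℝ) : ℂ)) (𝓝[>] 0)
      (𝓝 (iteratedFDeriv ℝ 3 H 0 ![(![1, -1, 0] : Fin 3 → ℝ), (![1, -1, 0] : Fin 3 → ℝ), (![1, -1, 0] : Fin 3 → ℝ)])) := by
    refine hT3'.congr' ?_
    filter_upwards [hcube] with u hu
    simpa only [Function.comp_apply] using hu
  obtain ⟨hval, hrel0, hrel1⟩ := quarter_sub_eq_of_wallGerms hδ hψ hχ hL₁ hL₂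
  refine ⟨?_, hrel0, hrel1⟩
  rw [lambda8Angle_zero_eq_quarter_wall01_form H hU h0 hH]
  exact hval

end ReductionNeg

end Literature.NumberTheory.Rogawski1990
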